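import Summits.QuantumFields.BalabanUV.T4Continuum.Spine.NE4.Targets
import Summits.QuantumFields.BalabanUV.T4Continuum.Spine.NE4.KingCurrencyWindow
import Summits.QuantumFields.BalabanUV.T4Continuum.Spine.NE4.KingCurrencyPointwise
import Summits.QuantumFields.BalabanUV.T4Continuum.Spine.NE4.KingCurrencyGapEnd

/-!
# Spine/NE4/KingCurrencyTargets — node U2's King-currency input and output STATED ON THE DATA `D : FiniteEpsData`, next to
# generation 0's `Spine/NE4/Targets` (`NE4OnData`, `U2Inputs`, `U2Output`): the rate-free input `PointwiseOnData` and the output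
# `KingOutput` (direct matching of D's tuned runs at every fixed infrared depth, uniformly in the cutoff gap)

Cell `pub-balaban-gaps` (YM blitz G2), seat `ne4` generation 13 (unit `pub-balaban-gaps-ne4-g13`), record `HOME/ne/NE4.md` §5 census
item (R51); data-level companion of `Spine/NE4/KingCurrency{,Window,Pointwise}` exactly as `Spine/NE4/Targets` (p338704) is the
data-level companion of `T4CouplingMatching`.  Two SHAPES on the data and three bookkeeping faces; nothing of Bałaban's asserted.

* `PointwiseOnData D γ` — (P) ON THE DATA: along every box-valued reversed coupling history `h`, the β-values
  `k ↦ D.βfun k (revHist h k)` form a Cauchy sequence (Bałaban's β-function HAS A LIMIT as the cutoff is removed, history by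
  history; NO rate, NO uniformity).  `NE4OnData D c θ γ` (`θ < 1`) implies it (`pointwiseOnData_of_ne4OnData`).  NOT PRINTED.
* `KingOutput D g₀` — NODE U2's OUTPUT IN KING's CURRENCY along the bare-coupling sequence `g₀`: for every depth `M` and `ε > 0`
  a `K₀` with `|g^{(K+n)}_{j+n} − g^{(K)}_j| ≤ ε` for all `K ≥ K₀`, all `n`, `K − M ≤ j ≤ K` (the runs `runFlow D g₀ K`).
* `kingOutput_of_pointwise` — `PointwiseOnData D γ` + the memory companion `HistLipschitz Λ γ D.βfun`, `FadingMemory C θ Λ` + the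
  printed-type bound `|β| ≤ B` + `EventualLowerH b γ k₀ D.βfun` + `BetaUpperH β′ γ D.βfun` with `γ²β′ < 1` (only to run (0.20)
  forward, `rgEqH_of_tuned`) + a sequence `g₀` TUNED to `g` within `]0,γ]` + the window `C((k₀+1)γ³ + 2γ∕b) ≤ (1−θ)∕2` ⟹
  `KingOutput D g₀` (`KingCurrencyPointwise.exists_uniformShift_of_pointwise` then `KingCurrencyWindow.direct_matching_eventually`);
  `kingOutput_of_u2Inputs` — the consecutive triple `U2Inputs D c C θ γ Λ` of `Targets` (with the same AF binders and bound) gives it too.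

GENERATION 14 ADDENDUM (v3, census (R52); `Spine/NE4/KingCurrencyGap` p385980 ✓ + `Spine/NE4/KingCurrencyGapEnd`): §3 adds the AF-FREE faces
`kingOutput_of_pointwise_free` ∕ `kingOutput_of_u2Inputs_free` — the SAME outputs with `0 < b`, `EventualLowerH b γ k₀ D.βfun` and the AF
window `C((k₀+1)γ³ + 2γ∕b) ≤ (1−θ)∕2` REPLACED by the one window `4·C·γ³ ≤ (1−θ)²` (`KingCurrencyGapEnd.direct_matching_eventually_of_pointwise_free`:
node U2 direct by the growing-envelope fixed point); the printed-type upper bound `BetaUpperH β′` with `γ²β′ < 1` stays ONLY to run (0.20)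
forward inside the box from the tuned bare couplings (`rgEqH_of_tuned`).  By `Spine/NE4/KingCurrencyWindowWitness` no face without a window exists.
§1–§2 (generation 13, p389849 ✓ e0323e1682c3) are byte-identical below.

PRIOR ART IN THE TREE (credit).  The pub-balaban NE7 #2 crux lineage's route «PAIR-CAUCHY» (`Support/NE7Pairwise*`, b2b-balaban-t4-ne7-p2
gens 48–49, 2026-08-21∕22) already runs node U2 on the cutoff pair with the rate-free n-layer scale-shift modulus: `NE7PairwiseScaleShift` (σ)
is `KingCurrency.UniformShift` verbatim, `NE7PairwiseCouplingStep.discOff_step` is `KingCurrency.discAt_step`, and `NE7PairwiseMarginalBox` ∕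
`NE7PairwiseCouplingDock.couplingGap_tendsto_zero` ∕ `NE7PairwiseCouplingUniform.couplingGap_uniform` give `KingCurrencyWindow.direct_matching_eventually`'s
conclusion; `NE7PairwiseOffsetEnd` has the pairwise apex.  What the (R51) chain adds: the Arzelà–Ascoli upgrade of `KingCurrencyPointwise`
((σ) from POINTWISE convergence along histories + the memory companion), the bridge to the ne9 seat's tower of `KingCurrencyTransport`,
the witness `KingCurrency.harmonicOsc`, and the composition below.

HONEST FRAMING.  Hypothesis SHAPES on the data and bookkeeping (0 sorry, standard axioms); every β-side shape is an UNPRINTED binder;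
NE4 ∕ (P) NOT IN PRINT ∕ NOT PROVED; spine PROVED 0∕9 before and after this file; rung (B)+1 on ONE finite T⁴ — NOT ℝ⁴, NOT infinite
volume, NOT a mass gap, NOT Clay.

References (TYPES only): [Balaban1987RG1] = T. Bałaban, Commun. Math. Phys. **109** (1987) 249–301, (0.20) p. 256, Thm 2 p. 259, p. 264.
-/

noncomputable section

namespace Summit.QuantumFields.BalabanUV.T4Continuum.Spine.NE4.KingCurrencyTargets

open Filter Topology
open Literature.MathematicalPhysics.QuantumFieldTheory.Balaban1983to89
open Literature.MathematicalPhysics.QuantumFieldTheory.Balaban1983to89.FlowStep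
open Literature.MathematicalPhysics.QuantumFieldTheory.Balaban1983to89.T4CouplingMatching
open Literature.MathematicalPhysics.QuantumFieldTheory.Balaban1983to89.T4Continuum
open Literature.MathematicalPhysics.QuantumFieldTheory.Balaban1983to89.T4TwoRunUniqueness
open Literature.MathematicalPhysics.QuantumFieldTheory.Balaban1983to89.T4BetaStationary
open Summit.QuantumFields.BalabanUV.T4Continuum.Spine.NE4
open Summit.QuantumFields.BalabanUV.T4Continuum.Spine.NE4.KingCurrency
open Summit.QuantumFields.BalabanUV.T4Continuum.Spine.NE4.KingCurrencyWindow (direct_matching_eventually)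
open Summit.QuantumFields.BalabanUV.T4Continuum.Spine.NE4.KingCurrencyPointwise
  (exists_uniformShift_of_pointwise pointwise_of_scaleShiftRate)
open Summit.QuantumFields.BalabanUV.T4Continuum.Spine.NE4.KingCurrencyGapEnd (direct_matching_eventually_of_pointwise_free)

universe u

variable {F : T4Family} {G : Type u} [GaugeGroup G] [MeasurableSpace G] [HaarData G]

/-! ## §1 The two shapes on the data -/

/-- [shape] **(P) ON THE DATA — the King-currency β-side input**: along every box-valued reversed coupling history `h` the β-values of
Bałaban's data `k ↦ D.βfun k (revHist h k)` form a CAUCHY sequence — the β-function has a limit as the cutoff is removed, history by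
history, NO rate, NO uniformity.  NOT PRINTED ([Balaban1987RG1] p. 264 says nothing on the `j`-dependence of `β_{j+1}`); implied by
`NE4OnData` (`pointwiseOnData_of_ne4OnData`), strictly weaker (`KingCurrency.harmonicOsc_not_scaleShiftRate`). [cite: Balaban1987RG1, §1 p.264] -/
def PointwiseOnData (D : FiniteEpsData F G) (γ : ℝ) : Prop :=
  ∀ h : ℕ → ℝ, SeqBox γ h → CauchySeq fun k => D.βfun k (revHist h k)

/-- [shape] **NODE U2's OUTPUT IN KING's CURRENCY ON THE DATA** along the bare-coupling sequence `g₀`: the couplings of the runs with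
`K` and `K + n` steps match at every fixed INFRARED depth `M` for large `K`, UNIFORMLY in the gap `n` — the input of node U6 in King's
organisation (`KingCurrencyTransport.cauchySeq_genFun_of_directMatching`).  NOT a fact. [folklore] -/
def KingOutput (D : FiniteEpsData F G) (g₀ : ℕ → ℝ) : Prop :=
  ∀ (M : ℕ) (ε : ℝ), 0 < ε → ∃ K₀ : ℕ, ∀ K n j : ℕ, K₀ ≤ K → K ≤ j + M → j ≤ K →
    |runFlow D g₀ (K + n) (j + n) - runFlow D g₀ K j| ≤ ε

/-! ## §2 Bookkeeping faces -/

/-- [bookkeeping] NE4 on the data (with `θ < 1`) implies (P) on the data (`T4BetaStationary.tendsto_betaInf`). [folklore] -/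
theorem pointwiseOnData_of_ne4OnData (D : FiniteEpsData F G) {c θ γ : ℝ} (h : NE4OnData D c θ γ) (hθ1 : θ < 1) :
    PointwiseOnData D γ :=
  pointwise_of_scaleShiftRate ((ne4OnData_iff D c θ γ).mp h) hθ1

/-- [bookkeeping] **NODE U2's KING OUTPUT ON THE DATA ⇐ (P) + THE MEMORY COMPANION + THE AF BINDERS** (run-wise, one `γ`): (P) on the
`γ`-box histories, `HistLipschitz Λ γ D.βfun` with `FadingMemory C θ Λ`, the printed-type bound `|β| ≤ B` on the boxes, the eventual
lower bound `EventualLowerH b γ k₀ D.βfun` (`b > 0`), the printed-type upper bound `BetaUpperH β′ γ D.βfun` with `γ²β′ < 1` (only to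
run (0.20) forward, `rgEqH_of_tuned`), a sequence `g₀` TUNED to `g` within `]0,γ]`, and the window `C·((k₀+1)γ³ + 2γ∕b) ≤ (1−θ)∕2`
give `KingOutput D g₀` — `exists_uniformShift_of_pointwise` (Arzelà–Ascoli) then `direct_matching_eventually` applied to
`g := runFlow D g₀`, `gIR := g`.  NO RATE of the β-functions is used.  Every β-side binder UNPRINTED. [folklore] -/
theorem kingOutput_of_pointwise (D : FiniteEpsData F G) {γ b θ C B β' g : ℝ} {k₀ : ℕ} {Λ : ℕ → ℕ → ℝ} {g₀ : ℕ → ℝ}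
    (hγ : 0 < γ) (hb : 0 < b) (hθ0 : 0 < θ) (hθ1 : θ < 1)
    (hP : PointwiseOnData D γ) (hL : HistLipschitz Λ γ D.βfun) (hΛ : FadingMemory C θ Λ)
    (hbd : ∀ k (v : Fin (k + 1) → ℝ), v ∈ Box γ k → |D.βfun k v| ≤ B)
    (hlo : EventualLowerH b γ k₀ D.βfun) (hhi : BetaUpperH β' γ D.βfun) (hγβ : γ ^ 2 * β' < 1) (ht : D.Tuned γ g g₀)
    (hsmall : C * (((k₀ : ℝ) + 1) * γ ^ 3 + 2 * γ / b) ≤ (1 - θ) / 2) :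
    KingOutput D g₀ := by
  have hC : 0 ≤ C := constant_nonneg_of_fadingMemory hΛ
  obtain ⟨hbox, hpin⟩ := box_and_pin_of_tuned D ht
  obtain ⟨ω, hω0, hωlim, hS⟩ := exists_uniformShift_of_pointwise hγ hθ0.le hθ1 hL hΛ hbd hP
  exact direct_matching_eventually (runFlow D g₀) g hγ hb hθ0 hθ1 hC
    (fun K => rgEqH_of_tuned D hhi hγβ hγ le_rfl ht K) hbox hpin hS hω0 hωlim hL hΛ hlo hsmall

/-- [bookkeeping] … in particular from generation 0's CONSECUTIVE input triple `U2Inputs D c C θ γ Λ` (NE4 + moduli + fading memory),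
with the same binders plus the printed-type bound: the King output is weaker than (indeed implied by the inputs of) `U2Output`. [folklore] -/
theorem kingOutput_of_u2Inputs (D : FiniteEpsData F G) {c γ b θ C B β' g : ℝ} {k₀ : ℕ} {Λ : ℕ → ℕ → ℝ} {g₀ : ℕ → ℝ}
    (hI : U2Inputs D c C θ γ Λ) (hγ : 0 < γ) (hb : 0 < b) (hθ0 : 0 < θ) (hθ1 : θ < 1)
    (hbd : ∀ k (v : Fin (k + 1) → ℝ), v ∈ Box γ k → |D.βfun k v| ≤ B)
    (hlo : EventualLowerH b γ k₀ D.βfun) (hhi : BetaUpperH β' γ D.βfun) (hγβ : γ ^ 2 * β' < 1) (ht : D.Tuned γ g g₀)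
    (hsmall : C * (((k₀ : ℝ) + 1) * γ ^ 3 + 2 * γ / b) ≤ (1 - θ) / 2) :
    KingOutput D g₀ :=
  kingOutput_of_pointwise D hγ hb hθ0 hθ1 (pointwiseOnData_of_ne4OnData D hI.ne4 hθ1) hI.2.1 hI.2.2 hbd hlo hhi hγβ ht hsmall

/-! ## §3 The AF-free faces (generation 14, census (R52)) -/

/-- [bookkeeping] **NODE U2's KING OUTPUT ON THE DATA ⇐ (P) + THE MEMORY COMPANION, WITHOUT ASYMPTOTIC FREEDOM** (run-wise, one `γ`):
(P) on the `γ`-box histories, `HistLipschitz Λ γ D.βfun` with `FadingMemory C θ Λ`, the printed-type bound `|β| ≤ B` on the boxes, the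
printed-type upper bound `BetaUpperH β′ γ D.βfun` with `γ²β′ < 1` (ONLY to run (0.20) forward, `rgEqH_of_tuned`), a sequence `g₀` TUNED to
`g` within `]0,γ]`, and the ONE window `4·C·γ³ ≤ (1−θ)²` give `KingOutput D g₀` — `KingCurrencyGapEnd.direct_matching_eventually_of_pointwise_free`
applied to `g := runFlow D g₀`, `gIR := g`.  Compared with `kingOutput_of_pointwise`: NO `0 < b`, NO `EventualLowerH b γ k₀`, NO AF window.
NO RATE of the β-functions is used.  Every β-side binder UNPRINTED. [folklore] -/
theorem kingOutput_of_pointwise_free (D : FiniteEpsData F G) {γ θ C B β' g : ℝ} {Λ : ℕ → ℕ → ℝ} {g₀ : ℕ → ℝ}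
    (hγ : 0 < γ) (hθ0 : 0 < θ) (hθ1 : θ < 1)
    (hP : PointwiseOnData D γ) (hL : HistLipschitz Λ γ D.βfun) (hΛ : FadingMemory C θ Λ)
    (hbd : ∀ k (v : Fin (k + 1) → ℝ), v ∈ Box γ k → |D.βfun k v| ≤ B)
    (hhi : BetaUpperH β' γ D.βfun) (hγβ : γ ^ 2 * β' < 1) (ht : D.Tuned γ g g₀)
    (hsmall : 4 * C * γ ^ 3 ≤ (1 - θ) ^ 2) :
    KingOutput D g₀ := by
  have hC : 0 ≤ C := constant_nonneg_of_fadingMemory hΛ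
  obtain ⟨hbox, hpin⟩ := box_and_pin_of_tuned D ht
  exact direct_matching_eventually_of_pointwise_free (runFlow D g₀) g hγ hθ0 hθ1 hC
    (fun K => rgEqH_of_tuned D hhi hγβ hγ le_rfl ht K) hbox hpin hL hΛ hbd hP hsmall

/-- [bookkeeping] … in particular from generation 0's CONSECUTIVE input triple `U2Inputs D c C θ γ Λ` (NE4 + moduli + fading memory) with the
printed-type bounds, the tuned sequence and the window `4·C·γ³ ≤ (1−θ)²` — NO asymptotic-freedom lower bound. [folklore] -/
theorem kingOutput_of_u2Inputs_free (D : FiniteEpsData F G) {c γ θ C B β' g : ℝ} {Λ : ℕ → ℕ → ℝ} {g₀ : ℕ → ℝ}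
    (hI : U2Inputs D c C θ γ Λ) (hγ : 0 < γ) (hθ0 : 0 < θ) (hθ1 : θ < 1)
    (hbd : ∀ k (v : Fin (k + 1) → ℝ), v ∈ Box γ k → |D.βfun k v| ≤ B)
    (hhi : BetaUpperH β' γ D.βfun) (hγβ : γ ^ 2 * β' < 1) (ht : D.Tuned γ g g₀)
    (hsmall : 4 * C * γ ^ 3 ≤ (1 - θ) ^ 2) :
    KingOutput D g₀ :=
  kingOutput_of_pointwise_free D hγ hθ0 hθ1 (pointwiseOnData_of_ne4OnData D hI.ne4 hθ1) hI.2.1 hI.2.2 hbd hhi hγβ ht hsmall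

end Summit.QuantumFields.BalabanUV.T4Continuum.Spine.NE4.KingCurrencyTargets
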